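import Literature.AlgebraicGeometry.Motives.AbelianVarietyGassmannPairDeflation
import HarnessLib

/-!
# GASSMANN PAIRS INDUCE: if `H₁, H₂ ≤ G ≤ Γ` are Gassmann equivalent IN `G`, they are Gassmann equivalent in
# every finite overgroup `Γ` — hence `B_{H₁} ∼ B_{H₂}` for every action of `Γ` on an abelian variety, the
# hypothesis being checked inside `G` only — ALGEBRAIC carrier, Hom counts over an arbitrary field, isogeny and
# dimensions over a perfect field

Layer A1/A2 of the Hodge foundations lane (`lit-hodgefound`, row A1-20⁺ · A2, seat p03 generation 25, row g25-#13) on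
the ALGEBRAIC carrier `AbelianVariety K` of `Motives/AbelianVariety`; the third functoriality of Brauer relations for
Gassmann pairs, after INFLATION (`Motives/AbelianVarietyBrauerRelationInflation`) and DEFLATION
(`Motives/AbelianVarietyBrauerRelationDeflation`, `Motives/AbelianVarietyGassmannPairDeflation`; CONSUMED from the
latter: `sum_eq_of_gassmann` — Gassmann equivalent subgroups give equal sums of every class function — and
`sum_boole_isConj_eq_card`), with `Motives/AbelianVarietyBrauerRelationInflation.card_isConj_eq_of_card_conj_mem_eq`,
`Motives/AbelianVarietyBrauerRelationIsogenies.{card_conj_mem_eq_of_gassmann, finrank_hom_image_eq_of_gassmann}` and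
`isIsogenous_of_card_conj_mem_eq`.  "Induction. If `G'` is a group containing `G`, then, by transitivity of
induction, `Θ` can be induced to a `G'`-relation `Ind^{G'} Θ = Σ_i n_i H_i`" — here for `Θ = H₁ − H₂`: a class
function of `Γ` restricts to a class function of `G`, so `Σ_{H₁} f = Σ_{H₂} f` for all `G`-class functions gives the
same for all `Γ`-class functions, in particular for the indicator of a `Γ`-conjugacy class.  Everything is PROVED; the
file introduces NO definition and NO named fact (net Literature debt 0).

## Sources, verbatim

A. Bartel, T. Dokchitser, *Brauer relations in finite groups*, JEMS **17** (2015), arXiv 1103.2047 (held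
`paper:arxiv-1103.2047`), §2 (p0006): "Relations can be induced from and restricted to subgroups, and lifted from
and projected to quotients as follows: let `Θ = Σ_i n_i H_i` be a `G`-relation. • Induction. If `G'` is a group
containing `G`, then, by transitivity of induction, `Θ` can be induced to a `G'`-relation `Ind^{G'} Θ = Σ_i n_i H_i`."
D. Neftin, *Admissibility and field relations*, Israel J. Math. (arXiv 0910.4156, held `paper:arxiv-0910.4156`),
proof of Prop. 3.10 (p0014): "As `H` and `H'` are Gassmann equivalent in `S_n` (and also in `Γ`) …" for
`Γ = Gal(T/F) × S_n ⊇ S_n`.  D. Prasad, C. S. Rajan, arXiv:math/0203295, §2, Cor. 4; E. Kani, M. Rosen, Math. Ann.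
284 (1989), Thm. 3.

## Dictionary and what is proved

`Γ` finite, `G ≤ Γ` (`Subgroup Γ`), `H₁, H₂ ≤ Γ` with `H₁, H₂ ≤ G`; "in `G`" means for the subgroups
`H_i.subgroupOf G ≤ G` and conjugacy by elements of `G`; marks `m^Γ_H(γ) = |{x ∈ Γ : x⁻¹γx ∈ H}|`,
`m^G_H(g) = |{x ∈ G : x⁻¹gx ∈ H}|`.

* §1 `sum_subgroupOf_eq` (sums over `H.subgroupOf G` are sums over `H`), **`card_isConj_eq_of_gassmann_subgroupOf`**
  (`|g^G ∩ H₁| = |g^G ∩ H₂|` for all `g ∈ G` ⟹ `|γ^Γ ∩ H₁| = |γ^Γ ∩ H₂|` for all `γ ∈ Γ`),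
  **`card_conj_mem_eq_of_card_conj_mem_subgroupOf_eq`** (equal marks in `G` ⟹ equal marks in `Γ`: the permutation
  representations `ℚ[Γ/H₁] = Ind_G^Γ ℚ[G/H₁]` and `ℚ[Γ/H₂]` agree).
* §2 (any field) **`finrank_hom_image_eq_of_card_conj_mem_subgroupOf_eq`**; (perfect field)
  **`isIsogenous_of_card_conj_mem_subgroupOf_eq`** (`B_{H₁} ∼ B_{H₂}` for every `Γ`-action, given equal marks in
  `G`), **`dim_eq_of_card_conj_mem_subgroupOf_eq`**.

Scope (stated, not hidden). (1) Only the pair case `Θ = H₁ − H₂` of "Induction" (general relations induce by the same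
argument but are not restated).  (2) The converse fails (subgroups conjugate in `Γ` need not be Gassmann equivalent in
`G`); not claimed.  (3) Hom counts over ANY field; isogeny and dimensions over a PERFECT field.

## References

* [BartelDokchitser2015] A. Bartel, T. Dokchitser, JEMS 17 (2015), arXiv:1103.2047, §2 (Induction).
* [Neftin2009] D. Neftin, Admissibility and field relations, arXiv:0910.4156, proof of Prop. 3.10.
* [PrasadRajan2003] D. Prasad, C. S. Rajan, J. Number Theory 99 (2003), arXiv:math/0203295, §2, Cor. 4.
* [KaniRosen1989] E. Kani, M. Rosen, Math. Ann. 284 (1989) 307–327, Thm. 3.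
-/

noncomputable section

universe u

open CategoryTheory CategoryTheory.Limits

namespace Literature.AlgebraicGeometry.Motives

namespace AbelianVariety

/-! ## §1 Gassmann equivalence in `G ≤ Γ` induces Gassmann equivalence in `Γ` -/

section GassmannInduction

variable {Γ : Type} [Group Γ] [Fintype Γ] (G H₁ H₂ : Subgroup Γ)

omit [Fintype Γ] in
/-- Sums over `H.subgroupOf G` (`H ≤ G`) are sums over `H` (Mathlib's `Subgroup.subgroupOfEquivOfLe`).
[cite: BartelDokchitser2015, §2 (Induction)] -/
theorem sum_subgroupOf_eq {M : Type*} [AddCommMonoid M] (H : Subgroup Γ) (hle : H ≤ G)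
    [Fintype (H.subgroupOf G)] [Fintype H] (f : Γ → M) :
    ∑ h : H.subgroupOf G, f ((h : G) : Γ) = ∑ h : H, f h :=
  Fintype.sum_equiv (Subgroup.subgroupOfEquivOfLe hle).toEquiv _ _ fun _ ↦ rfl

/-- **Gassmann equivalence induces to overgroups**: if `H₁, H₂ ≤ G ≤ Γ` and `|g^G ∩ H₁| = |g^G ∩ H₂|` for every
`g ∈ G` (conjugacy inside `G`), then `|γ^Γ ∩ H₁| = |γ^Γ ∩ H₂|` for every `γ ∈ Γ` — the indicator of `γ^Γ` restricts
to a class function of `G` ("by transitivity of induction, `Θ` can be induced to a `G'`-relation"; "Gassmann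
equivalent in `S_n` (and also in `Γ`)"). [cite: BartelDokchitser2015, §2 (Induction)] [cite: Neftin2009, proof of Prop. 3.10]
[cite: PrasadRajan2003, §2] -/
theorem card_isConj_eq_of_gassmann_subgroupOf (h₁ : H₁ ≤ G) (h₂ : H₂ ≤ G)
    (hG : ∀ g : G, Nat.card {h : H₁.subgroupOf G // IsConj g h} = Nat.card {h : H₂.subgroupOf G // IsConj g h})
    (γ : Γ) : Nat.card {h : H₁ // IsConj γ h} = Nat.card {h : H₂ // IsConj γ h} := by
  classical
  let F : Γ → ℤ := fun x ↦ if IsConj γ x then 1 else 0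
  have hf : ∀ a g : G, F ((a * g * a⁻¹ : G) : Γ) = F ((g : G) : Γ) := fun a g ↦ by
    have e : IsConj γ ((a : Γ) * g * (a : Γ)⁻¹) ↔ IsConj γ g :=
      ⟨fun h ↦ h.trans (isConj_iff.2 ⟨(a : Γ)⁻¹, by group⟩), fun h ↦ h.trans (isConj_iff.2 ⟨a, rfl⟩)⟩
    simp only [F, Subgroup.coe_mul, Subgroup.coe_inv, e]
  have h := sum_eq_of_gassmann (H₁.subgroupOf G) (H₂.subgroupOf G) hG (fun g : G ↦ F g) hf
  change ∑ h : H₁.subgroupOf G, F ((h : G) : Γ) = ∑ h : H₂.subgroupOf G, F ((h : G) : Γ) at h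
  rw [sum_subgroupOf_eq G H₁ h₁ F, sum_subgroupOf_eq G H₂ h₂ F] at h
  have e : ∀ (H : Subgroup Γ), (∑ k : H, F k) = Nat.card {k : H // IsConj γ k} := fun H ↦
    sum_boole_isConj_eq_card H γ
  rw [e, e] at h
  exact_mod_cast h

/-- **Equal marks induce**: if `|{x ∈ G : x⁻¹gx ∈ H₁}| = |{x ∈ G : x⁻¹gx ∈ H₂}|` for every `g ∈ G` (the
permutation representations `ℚ[G/H₁] ≅ ℚ[G/H₂]`), then `|{x ∈ Γ : x⁻¹γx ∈ H₁}| = |{x ∈ Γ : x⁻¹γx ∈ H₂}|` for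
every `γ ∈ Γ` (`ℚ[Γ/H_i] = Ind_G^Γ ℚ[G/H_i]`). [cite: BartelDokchitser2015, §2 (Induction)] [cite: Neftin2009, proof of Prop. 3.10] -/
theorem card_conj_mem_eq_of_card_conj_mem_subgroupOf_eq (h₁ : H₁ ≤ G) (h₂ : H₂ ≤ G)
    (hm : ∀ g : G, Nat.card {x : G // x⁻¹ * g * x ∈ H₁.subgroupOf G} =
      Nat.card {x : G // x⁻¹ * g * x ∈ H₂.subgroupOf G}) (γ : Γ) :
    Nat.card {x : Γ // x⁻¹ * γ * x ∈ H₁} = Nat.card {x : Γ // x⁻¹ * γ * x ∈ H₂} := by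
  classical
  haveI : Fintype H₁ := Fintype.ofFinite _
  haveI : Fintype H₂ := Fintype.ofFinite _
  exact card_conj_mem_eq_of_gassmann H₁ H₂
    (card_isConj_eq_of_gassmann_subgroupOf G H₁ H₂ h₁ h₂ (card_isConj_eq_of_card_conj_mem_eq _ _ hm)) γ

end GassmannInduction

/-! ## §2 `B_{H₁} ∼ B_{H₂}` for every `Γ`-action, from equal marks in `G` -/

section GassmannInductionAV

variable {K : Type u} [Field K] {X : AbelianVariety K} {Γ : Type} [Group Γ] [Fintype Γ] (ρ : Γ →* End X)
  (G H₁ H₂ : Subgroup Γ) [Fintype H₁] [Fintype H₂] {N₁ N₂ : X ⟶ X}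

/-- **Equal Hom counts from Gassmann equivalence in a subgroup** (any field): for an action of `Γ` on `X`,
`H₁, H₂ ≤ G ≤ Γ` with equal marks in `G`, and every `B`: **`rk Hom(B_{H₁}, B) = rk Hom(B_{H₂}, B)`**.
[cite: BartelDokchitser2015, §2 (Induction)] [cite: PrasadRajan2003, Cor. 4] [cite: KaniRosen1989, Thm. 3] -/
theorem finrank_hom_image_eq_of_card_conj_mem_subgroupOf_eq (h₁ : H₁ ≤ G) (h₂ : H₂ ≤ G)
    (hm : ∀ g : G, Nat.card {x : G // x⁻¹ * g * x ∈ H₁.subgroupOf G} =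
      Nat.card {x : G // x⁻¹ * g * x ∈ H₂.subgroupOf G})
    (hN₁ : End.of N₁ = ∑ h : H₁, ρ h) (hN₂ : End.of N₂ = ∑ h : H₂, ρ h) (B : AbelianVariety K) :
    Module.finrank ℤ (image N₁ ⟶ B) = Module.finrank ℤ (image N₂ ⟶ B) :=
  finrank_hom_image_eq_of_gassmann ρ H₁ H₂
    (card_isConj_eq_of_gassmann_subgroupOf G H₁ H₂ h₁ h₂ (card_isConj_eq_of_card_conj_mem_eq _ _ hm)) hN₁ hN₂ B

variable [PerfectField K]

/-- **Induced Gassmann pairs give isogenous `B`'s** (perfect field): **`B_{H₁} ∼ B_{H₂}`** for every action of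
`Γ` on an abelian variety, as soon as `H₁, H₂ ≤ G ≤ Γ` have equal marks IN `G` ("`Θ` can be induced to a
`G'`-relation"; "For every Brauer relation … there is an isogeny"). [cite: BartelDokchitser2015, §2 (Induction)]
[cite: Neftin2009, proof of Prop. 3.10] [cite: PrasadRajan2003, Cor. 4] [cite: KaniRosen1989, Thm. 3] -/
theorem isIsogenous_of_card_conj_mem_subgroupOf_eq (h₁ : H₁ ≤ G) (h₂ : H₂ ≤ G)
    (hm : ∀ g : G, Nat.card {x : G // x⁻¹ * g * x ∈ H₁.subgroupOf G} =
      Nat.card {x : G // x⁻¹ * g * x ∈ H₂.subgroupOf G})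
    (hN₁ : End.of N₁ = ∑ h : H₁, ρ h) (hN₂ : End.of N₂ = ∑ h : H₂, ρ h) : IsIsogenous (image N₁) (image N₂) :=
  isIsogenous_of_card_conj_mem_eq ρ H₁ H₂
    (card_conj_mem_eq_of_card_conj_mem_subgroupOf_eq G H₁ H₂ h₁ h₂ hm) hN₁ hN₂

/-- **Dimensions: `dim B_{H₁} = dim B_{H₂}`** (perfect field). [cite: BartelDokchitser2015, §2 (Induction)]
[cite: PrasadRajan2003, Cor. 4] -/
theorem dim_eq_of_card_conj_mem_subgroupOf_eq (h₁ : H₁ ≤ G) (h₂ : H₂ ≤ G)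
    (hm : ∀ g : G, Nat.card {x : G // x⁻¹ * g * x ∈ H₁.subgroupOf G} =
      Nat.card {x : G // x⁻¹ * g * x ∈ H₂.subgroupOf G})
    (hN₁ : End.of N₁ = ∑ h : H₁, ρ h) (hN₂ : End.of N₂ = ∑ h : H₂, ρ h) : (image N₁).dim = (image N₂).dim :=
  (isIsogenous_of_card_conj_mem_subgroupOf_eq ρ G H₁ H₂ h₁ h₂ hm hN₁ hN₂).dim_eq

end GassmannInductionAV

end AbelianVariety

end Literature.AlgebraicGeometry.Motives
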